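import Summits.QuantumFields.BalabanUV.T4Continuum.Support.UrsellActivityNorm
import Summits.QuantumFields.BalabanUV.T4Continuum.Support.B13StepOfRecord

/-!
# NE5 ∕ U3 — convergence of the ORDERED series (2.13), part 6: ON BAŁABAN's CARRIERS OF RECORD — the geometric side DISCHARGED
# BY NAME; row O1-d3's `ClassBound`∕`TermRep` for the step model of record modulo EXACTLY a (2.38)-shape activity majorant

Cell `pub-balaban`, unit `b2b-balaban-t4-ne5-formalise-leaf-08` (NE5 formalisation swarm, LEAF PROVER 08; row O1-d2 follower (iii);
parts 1–5 = `Support/UrsellTreeSum` p208810, `UrsellSeriesBound` p209076, `UrsellTermBudget` p209547 (+`Levels` p209760), `UrsellTermDecay`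
p209970, `UrsellActivityNorm`).  Summits-side NEW WORK under the LEAN PLACEMENT RULE (cell bookkeeping).  HONEST FRAMING: rung (B)+1 of the
FINITE-VOLUME T⁴ continuum programme — NOT infinite volume, NOT a mass gap, NOT the Clay problem, NOT a proof of NE5.  HONEST DEPENDENCY
(cell line, verbatim): continuum YM on T⁴ ⇐ BetaPertH ∧ nine spine estimates (0/9 proved); BetaPertH ⇐ (D1) ∧ (D4) ∧ CAP+tail; G-an2-4
gates asym, D1 and NE2/3/4.

WHAT.  Part 5's `classBound_b13_of_printedShapes` ∕ `termRep_b13_of_printedShapes` hold for ANY domain geometry satisfying the displayed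
shapes (1.26), (2.30), (2.27) and a footprint-local reach.  On Bałaban's carriers of record (`R : B13Carriers.TwoRuns`) with route P2's
geometry of record `B13DomainGeometryTR.domainGeometry R` these five geometric inputs are THEOREMS of the tree (P2, p207848 lineage):
`loc_b13`, `reach_b13` (ν = 9), `ineq126_level` (κ₀ = 64·log 162, K₀ = K₀(64, 8)), `volBound_level` (c₁ = 64), `ineq227_level` (c = 5)
— transported from `TreeLengthTorusGeometry.tgeometry 4 N`.  THIS FILE plugs them in:
* **`classBound_b13_of_record`** ∕ **`termRep_b13_of_record`** — for ANY inner data `D` and ANY step model whose output is the B13 series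
  on the labels of record: a displayed nonnegative termwise activity majorant `𝒜 k g U` at the class points with (2.38)-SHAPE level sums
  `actSum(𝒜 k g U)(Z) ≤ ε·e^{−R d(Z)}`, the rate split `κ + 64·log 162 + 64 ≤ R` and the SMALLNESS `4·9·Φ′ < 1`, `Φ′ = ε e^{5κ} e^{64} K₀(64,8)`
  ⟹ `ClassBound M K W κ (Φ′/(1 − 36Φ′))` (and `TermRep` from `64·log 162 + 64 ≤ R`, `36·ε e^{64} K₀ < 1`);
* **`classBound_stepOfRecord`** ∕ **`termRep_stepOfRecord`** — the same for O1-e's STEP MODEL OF RECORD `B13StepOfRecord.step S E₀ cB`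
  (`hM := rfl` by `step_Out`; inner data `b13InnerData R`, activity slot `S.act`).
So for the model of record, row O1-d3's two binders are theorems modulo ONE displayed one-run input of the PRINTED kind: a termwise
majorant of the (2.14)-activity slot `S.act` whose level sums obey [Balaban1988RG2Cluster] Lemma 3 (2.38) p. 20 (*"|H(Z)| ≤ … exp(−κ
d_k(Z))"*, locator only) with a rate `R ≥ κ + 64·log 162 + 64` and `ε` small — supplier: rows NE2∕NE3 (the analytic estimates of [II]
§2–§3), NOT this crew.  The numerical constants are the tree's (GAPS G-B13-07 repaired (2.30); K₀ of `B12TreeDecay`), not the paper's.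
No definitions; 0 sorry; axioms ⊆ {propext, Classical.choice, Quot.sound}.
-/

noncomputable section

open scoped BigOperators

namespace Summit.QuantumFields.BalabanUV.T4Continuum.UrsellOfRecord

open Literature.MathematicalPhysics.QuantumFieldTheory.Balaban1983to89
open Literature.MathematicalPhysics.QuantumFieldTheory.Balaban1983to89.T4InputCauchyRateData (StepModel)
open Literature.MathematicalPhysics.QuantumFieldTheory.Balaban1983to89.T4InputCauchyRateSpecies (ClassBound)
open Literature.MathematicalPhysics.QuantumFieldTheory.Balaban1983to89.T4InputCauchyRateTermwise (TermRep)
open Summit.QuantumFields.BalabanUV.T4Continuum.B13Carriers (TwoRuns)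
open Summit.QuantumFields.BalabanUV.T4Continuum.B13OpDatum (OpDatum)
open Summit.QuantumFields.BalabanUV.T4Continuum.B13StepTermLabels (TermIdx InnerLabel InnerData)
open Summit.QuantumFields.BalabanUV.T4Continuum.B13StepTermFamily (term out)
open Summit.QuantumFields.BalabanUV.T4Continuum.B13StepTermSocket (labelsIndexing touchInc)
open Summit.QuantumFields.BalabanUV.T4Continuum.B13InnerData (Bnd b13InnerData)
open Summit.QuantumFields.BalabanUV.T4Continuum.B13DomainGeometryTR (domainGeometry loc_b13 reach_b13 ineq126_level volBound_level
  ineq227_level)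
open Summit.QuantumFields.BalabanUV.T4Continuum.B13StepOfRecord (Slots step)
open Summit.QuantumFields.BalabanUV.T4Continuum.UrsellTreeSum (ind)
open Summit.QuantumFields.BalabanUV.T4Continuum.UrsellTermBudget (actSum)
open Summit.QuantumFields.BalabanUV.T4Continuum.UrsellActivityNorm (classBound_b13_of_printedShapes termRep_b13_of_printedShapes)

variable {G : Type} [GaugeGroup G] (R : TwoRuns G)

/-! ## §1 Any step model on the labels of record -/

section AnyModel

variable {Bd : Type*} [DecidableEq Bd] (D : InnerData R.carriers Bd)
  {Op Hist : Type*} [NormedAddCommGroup Op] [NormedSpace ℂ Op] [NormedAddCommGroup Hist] [NormedSpace ℂ Hist]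

/-- [folklore] **`ClassBound` WITH RATE ON THE CARRIERS OF RECORD, modulo a (2.38)-shape activity majorant.**  Geometry of record
`B13DomainGeometryTR.domainGeometry R`; the five geometric inputs of part 5 are P2's theorems `loc_b13`, `reach_b13`, `ineq126_level`,
`volBound_level`, `ineq227_level` BY NAME. -/
theorem classBound_b13_of_record (act : R.carriers.Dom → InnerLabel R.carriers.Dom Bd → Op → Hist → ℂ)
    {M : StepModel R.carriers Op Hist}
    (hM : ∀ k o h X, M.Out k o h X = out (labelsIndexing (domainGeometry R) D) (touchInc (domainGeometry R)) act k o h X)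
    {K : ℕ → (ℕ → ℝ) → R.carriers.BgB → Set (Op × Hist)} {W : Set (ℕ → ℝ)}
    {𝒜 : ℕ → (ℕ → ℝ) → R.carriers.BgB → R.carriers.Dom → InnerLabel R.carriers.Dom Bd → ℝ} {ε Rt κ : ℝ} (hε : 0 ≤ ε) (hκ : 0 ≤ κ)
    (hR : κ + 64 * Real.log 162 + 64 ≤ Rt)
    (hsmall : 4 * 9 * (ε * Real.exp (κ * 5) * Real.exp 64 * B12TreeDecay.K₀ (4 * 2 ^ 4) (2 * 4)) < 1)
    (hA : ∀ k, ∀ g ∈ W, ∀ (U : R.carriers.BgB) (q : Op × Hist), q ∈ K k g U → ∀ X : R.carriers.Dom, R.carriers.scale X = k →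
      ∀ i : TermIdx R.carriers.Dom Bd, (labelsIndexing (domainGeometry R) D).Rel k i X →
        ∀ m, ‖act ((labelsIndexing (domainGeometry R) D).poly i m) ((labelsIndexing (domainGeometry R) D).lab i m) q.1 q.2‖ ≤
          𝒜 k g U ((labelsIndexing (domainGeometry R) D).poly i m) ((labelsIndexing (domainGeometry R) D).lab i m))
    (hA0 : ∀ k g U Z ℓ, 0 ≤ 𝒜 k g U Z ℓ)
    (h238 : ∀ k, ∀ g ∈ W, ∀ (U : R.carriers.BgB), ∀ Z ∈ R.domAt k, actSum D (𝒜 k g U) k Z ≤ ε * Real.exp (-(Rt * R.carriers.d Z))) :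
    ClassBound M K W κ ((ε * Real.exp (κ * 5) * Real.exp 64 * B12TreeDecay.K₀ (4 * 2 ^ 4) (2 * 4)) /
      (1 - 4 * 9 * (ε * Real.exp (κ * 5) * Real.exp 64 * B12TreeDecay.K₀ (4 * 2 ^ 4) (2 * 4)))) :=
  classBound_b13_of_printedShapes (domainGeometry R) D act hM hε hκ (by norm_num) (B12TreeDecay.K₀_pos _ _).le (by norm_num) hR
    hsmall hA hA0 h238 ineq126_level volBound_level ineq227_level B13DomainGeometryTR.reach (fun Z Z' h => loc_b13 Z Z' h) reach_b13

/-- [folklore] **`TermRep` ON THE CARRIERS OF RECORD, modulo a (2.38)-shape activity majorant** (no rate: `64·log 162 + 64 ≤ R`,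
smallness `4·9·(ε e^{64} K₀) < 1`). -/
theorem termRep_b13_of_record (act : R.carriers.Dom → InnerLabel R.carriers.Dom Bd → Op → Hist → ℂ)
    {M : StepModel R.carriers Op Hist}
    (hM : ∀ k o h X, M.Out k o h X = out (labelsIndexing (domainGeometry R) D) (touchInc (domainGeometry R)) act k o h X)
    {K : ℕ → (ℕ → ℝ) → R.carriers.BgB → Set (Op × Hist)} {W : Set (ℕ → ℝ)}
    {𝒜 : ℕ → (ℕ → ℝ) → R.carriers.BgB → R.carriers.Dom → InnerLabel R.carriers.Dom Bd → ℝ} {ε Rt : ℝ} (hε : 0 ≤ ε)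
    (hR : 64 * Real.log 162 + 64 ≤ Rt) (hsmall : 4 * 9 * (ε * Real.exp 64 * B12TreeDecay.K₀ (4 * 2 ^ 4) (2 * 4)) < 1)
    (hA : ∀ k, ∀ g ∈ W, ∀ (U : R.carriers.BgB) (q : Op × Hist), q ∈ K k g U → ∀ X : R.carriers.Dom, R.carriers.scale X = k →
      ∀ i : TermIdx R.carriers.Dom Bd, (labelsIndexing (domainGeometry R) D).Rel k i X →
        ∀ m, ‖act ((labelsIndexing (domainGeometry R) D).poly i m) ((labelsIndexing (domainGeometry R) D).lab i m) q.1 q.2‖ ≤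
          𝒜 k g U ((labelsIndexing (domainGeometry R) D).poly i m) ((labelsIndexing (domainGeometry R) D).lab i m))
    (hA0 : ∀ k g U Z ℓ, 0 ≤ 𝒜 k g U Z ℓ)
    (h238 : ∀ k, ∀ g ∈ W, ∀ (U : R.carriers.BgB), ∀ Z ∈ R.domAt k, actSum D (𝒜 k g U) k Z ≤ ε * Real.exp (-(Rt * R.carriers.d Z))) :
    TermRep M K (term (labelsIndexing (domainGeometry R) D) (touchInc (domainGeometry R)) act) W :=
  termRep_b13_of_printedShapes (domainGeometry R) D act hM hε (B12TreeDecay.K₀_pos _ _).le (by norm_num) hR hsmall hA hA0 h238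
    ineq126_level volBound_level B13DomainGeometryTR.reach (fun Z Z' h => loc_b13 Z Z' h) reach_b13

end AnyModel

/-! ## §2 The step model of record (row O1-e, `B13StepOfRecord.step`) -/

section OfRecord

variable {R} {E IOp Hist : Type*} [NormedAddCommGroup Hist] [NormedSpace ℂ Hist] (S : Slots R E IOp Hist) (E₀ cB : ℝ)

/-- [folklore] **ROW O1-d3's `ClassBound` FOR THE STEP MODEL OF RECORD, modulo EXACTLY a (2.38)-shape termwise majorant of the activity
slot `S.act`**: `ClassBound (step S E₀ cB) K W κ (Φ′/(1 − 36Φ′))`, `Φ′ = ε e^{5κ} e^{64} K₀(64, 8)`, from `κ + 64·log 162 + 64 ≤ R` and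
`4·9·Φ′ < 1` (`hM := rfl` by `B13StepOfRecord.step_Out`).  [Balaban1988RG2Cluster] Lemma 3 (2.38) p. 20 is cited as the LOCATOR of the one
displayed input; nothing of [II] is asserted. -/
theorem classBound_stepOfRecord {K : ℕ → (ℕ → ℝ) → R.carriers.BgB → Set (OpDatum E × Hist)} {W : Set (ℕ → ℝ)}
    {𝒜 : ℕ → (ℕ → ℝ) → R.carriers.BgB → R.carriers.Dom → InnerLabel R.carriers.Dom (Bnd R) → ℝ} {ε Rt κ : ℝ} (hε : 0 ≤ ε)
    (hκ : 0 ≤ κ) (hR : κ + 64 * Real.log 162 + 64 ≤ Rt)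
    (hsmall : 4 * 9 * (ε * Real.exp (κ * 5) * Real.exp 64 * B12TreeDecay.K₀ (4 * 2 ^ 4) (2 * 4)) < 1)
    (hA : ∀ k, ∀ g ∈ W, ∀ (U : R.carriers.BgB) (q : OpDatum E × Hist), q ∈ K k g U → ∀ X : R.carriers.Dom, R.carriers.scale X = k →
      ∀ i : TermIdx R.carriers.Dom (Bnd R), (labelsIndexing (domainGeometry R) (b13InnerData R)).Rel k i X →
        ∀ m, ‖S.act ((labelsIndexing (domainGeometry R) (b13InnerData R)).poly i m)
            ((labelsIndexing (domainGeometry R) (b13InnerData R)).lab i m) q.1 q.2‖ ≤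
          𝒜 k g U ((labelsIndexing (domainGeometry R) (b13InnerData R)).poly i m)
            ((labelsIndexing (domainGeometry R) (b13InnerData R)).lab i m))
    (hA0 : ∀ k g U Z ℓ, 0 ≤ 𝒜 k g U Z ℓ)
    (h238 : ∀ k, ∀ g ∈ W, ∀ (U : R.carriers.BgB), ∀ Z ∈ R.domAt k,
      actSum (b13InnerData R) (𝒜 k g U) k Z ≤ ε * Real.exp (-(Rt * R.carriers.d Z))) :
    ClassBound (step S E₀ cB) K W κ ((ε * Real.exp (κ * 5) * Real.exp 64 * B12TreeDecay.K₀ (4 * 2 ^ 4) (2 * 4)) /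
      (1 - 4 * 9 * (ε * Real.exp (κ * 5) * Real.exp 64 * B12TreeDecay.K₀ (4 * 2 ^ 4) (2 * 4)))) :=
  classBound_b13_of_record R (b13InnerData R) S.act (M := step S E₀ cB) (fun _ _ _ _ => rfl) hε hκ hR hsmall hA hA0 h238

/-- [folklore] **ROW O1-d3's `TermRep` FOR THE STEP MODEL OF RECORD, modulo EXACTLY a (2.38)-shape termwise majorant of `S.act`.** -/
theorem termRep_stepOfRecord {K : ℕ → (ℕ → ℝ) → R.carriers.BgB → Set (OpDatum E × Hist)} {W : Set (ℕ → ℝ)}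
    {𝒜 : ℕ → (ℕ → ℝ) → R.carriers.BgB → R.carriers.Dom → InnerLabel R.carriers.Dom (Bnd R) → ℝ} {ε Rt : ℝ} (hε : 0 ≤ ε)
    (hR : 64 * Real.log 162 + 64 ≤ Rt) (hsmall : 4 * 9 * (ε * Real.exp 64 * B12TreeDecay.K₀ (4 * 2 ^ 4) (2 * 4)) < 1)
    (hA : ∀ k, ∀ g ∈ W, ∀ (U : R.carriers.BgB) (q : OpDatum E × Hist), q ∈ K k g U → ∀ X : R.carriers.Dom, R.carriers.scale X = k →
      ∀ i : TermIdx R.carriers.Dom (Bnd R), (labelsIndexing (domainGeometry R) (b13InnerData R)).Rel k i X →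
        ∀ m, ‖S.act ((labelsIndexing (domainGeometry R) (b13InnerData R)).poly i m)
            ((labelsIndexing (domainGeometry R) (b13InnerData R)).lab i m) q.1 q.2‖ ≤
          𝒜 k g U ((labelsIndexing (domainGeometry R) (b13InnerData R)).poly i m)
            ((labelsIndexing (domainGeometry R) (b13InnerData R)).lab i m))
    (hA0 : ∀ k g U Z ℓ, 0 ≤ 𝒜 k g U Z ℓ)
    (h238 : ∀ k, ∀ g ∈ W, ∀ (U : R.carriers.BgB), ∀ Z ∈ R.domAt k,
      actSum (b13InnerData R) (𝒜 k g U) k Z ≤ ε * Real.exp (-(Rt * R.carriers.d Z))) :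
    TermRep (step S E₀ cB) K (term (labelsIndexing (domainGeometry R) (b13InnerData R)) (touchInc (domainGeometry R)) S.act) W :=
  termRep_b13_of_record R (b13InnerData R) S.act (M := step S E₀ cB) (fun _ _ _ _ => rfl) hε hR hsmall hA hA0 h238

end OfRecord

end Summit.QuantumFields.BalabanUV.T4Continuum.UrsellOfRecord

end
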